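import Literature.AlgebraicGeometry.HodgeTheory.KunnethComponentsDiagonalAlgebraicPart
import Literature.AlgebraicGeometry.HodgeTheory.HypersurfaceCutOutByLefschetz
import Literature.AlgebraicGeometry.HodgeTheory.FermatOddDegreeRestriction
import HarnessLib

/-!
# The Künneth standard conjecture `C(X)` for smooth hypersurfaces of `ℙⁿ⁺¹_ℂ`, for `ℙᴺ_ℂ`, and for every variety whose cohomology off the middle degree is algebraic in even degrees and zero in odd degrees

Family `hodge`, layer `Literature/AlgebraicGeometry/HodgeTheory`; lane `lit-hodgefound`. THEOREMS ONLY
(no definition, no named fact; D-0026). Sixth part of the story `KunnethComponentsOfHodgeClasses` /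
`KunnethComponentsDiagonalAlgebraicLowDegrees` / `KunnethComponentsDiagonalAction` /
`KunnethComponentsDiagonalAlgebraicPart` / `DiagonalClassLefschetzTraceFormula` on the carriers
`kunnethPiece`, `algebraicClasses X p = Nᵖ H²ᵖ(X(ℂ); ℂ)` and the Künneth families
`π : Fin (2n+1) → H²ⁿ((X ⊗ X)(ℂ); ℂ)` of `cl(Δ) = diagonalClass hX` (`π i ∈ H^{2n−i}(X) ⊗ Hⁱ(X)`,
`Σ π i = cl(Δ)`).

The Künneth standard conjecture `C(X)` (Voisin 2025 §3.2.1 after (14): "it is not known in general if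
each `δᵢ` is algebraic. This problem is the Künneth standard conjecture") holds as soon as the
cohomology of `X` OFF THE MIDDLE DEGREE is algebraic in even degrees and zero in odd degrees: then
every `πⁱ`, `i ≠ n`, lies in a piece `H^{2n−i}_alg ⊗ Hⁱ_alg` (algebraic — the summand `δ_alg` of Voisin
§5.3 (42), file `KunnethComponentsDiagonalAlgebraicPart`) or in a zero piece, and `πⁿ = cl(Δ) −
Σ_{i ≠ n} πⁱ` is algebraic with them (the argument of Voisin Cor. 3.9 for `δ₂` of a surface). By the
Lefschetz hyperplane theorem this covers every smooth hypersurface `X ⊂ ℙⁿ⁺¹_ℂ` (Voisin II Cor. 1.24 /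
1.25: off the middle degree `H•(X)` is the restriction of `H•(ℙⁿ⁺¹)`; the tree's PROVED
`algebraicClasses_eq_top_of_isHypersurfaceCutOutBy` and `subsingleton_complexBetti_of_odd`, file
`HypersurfaceCutOutByLefschetz`), and `ℙᴺ_ℂ` itself. The tree's `DiagonalKunnethComponentCasimir`
proved, under rational-level versions of the same hypotheses, that the PIECES off the middle are
algebraic and that SOME decomposition has an algebraic middle member; with the uniqueness of Künneth
components (`KunnethComponentsOfHodgeClasses`) the statement below is about EVERY Künneth family.

* `kunnethComponent_diagonalClass_mem_algebraicClasses_of_off_middle` — the general criterion;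
  `…_of_odd_vanishing` — the version without the middle exception (all odd cohomology zero, all even
  cohomology algebraic: `ℙᴺ`, Grassmannians, …);
* `…_of_isHypersurfaceCutOutBy`, `…_of_isSmoothHypersurface` — `C(X)` for smooth hypersurfaces;
* `…_projectiveSpace` — `C(ℙᴺ_ℂ)`.

## References

* [Voisin2025] C. Voisin, Hodge and generalized Hodge conjectures, coniveau and algebraic cycles,
  J. Open Math. Probl. 1 (2025) 16–51, §3.2.1 (14), Prop. 3.8, Cor. 3.9; §5.3 (42).
* [VoisinHodgeII2003] C. Voisin, Hodge Theory and Complex Algebraic Geometry II (2003), §1.2.3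
  Cor. 1.24, Cor. 1.25 (cohomology of hypersurfaces off the middle degree).
* [VoisinHodgeI2002] C. Voisin, Hodge Theory and Complex Algebraic Geometry I (2002), §11.3.3 p. 287.
* [Kleiman1968AlgebraicCycles] S. Kleiman, Algebraic cycles and the Weil conjectures (1968), §2 (`C(X)`).
* [HatcherAT2002] A. Hatcher, Algebraic Topology (2002), §2.2 Thm. 2.35 (iii) (`H•(ℂℙᴺ)`), §3.2
  Thm. 3.16.
-/

noncomputable section

open CategoryTheory AlgebraicGeometry MonoidalCategory CartesianMonoidalCategory Finset
open Literature.AlgebraicTopology.SingularHomology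
open Literature.AlgebraicGeometry.Motives

namespace Literature.AlgebraicGeometry.HodgeTheory

universe u

variable {n : ℕ} {X : SchemeOver ℂ}

/-! ### §1 The general criterion -/

/-- **`C(X)` when the cohomology off the middle degree is algebraic (even degrees) and zero (odd
degrees).** Let `X` be smooth projective of dimension `n` with `Hᵏ(X(ℂ); ℂ) = 0` for every odd `k ≠ n`
and `H^{2p}(X(ℂ); ℂ) = N^p H^{2p}` (spanned by algebraic classes) for every `2p ≠ n`. Then EVERY Künneth
component of `cl(Δ)`, in every Künneth decomposition, is algebraic: for `i ≠ n` odd the piece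
`H^{2n−i} ⊗ Hⁱ` is zero; for `i = 2q ≠ n` the piece `H^{2n−2q}_alg ⊗ H^{2q}_alg` is algebraic (both
degrees are off the middle); and `πⁿ = cl(Δ) − Σ_{i ≠ n} πⁱ`. [cite: Voisin2025, §3.2.1 Cor. 3.9 (proof) and §5.3 (42)]
[cite: Kleiman1968AlgebraicCycles, §2] -/
theorem kunnethComponent_diagonalClass_mem_algebraicClasses_of_off_middle (hX : IsSmoothProjective n X)
    (hodd : ∀ k : ℕ, Odd k → k ≠ n → Subsingleton (complexBetti X k))
    (heven : ∀ p : ℕ, 2 * p ≠ n → algebraicClasses X p = ⊤)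
    {π : Fin (2 * n + 1) → complexBetti (X ⊗ X) (2 * n)}
    (hπ : ∀ i : Fin (2 * n + 1), π i ∈ kunnethPiece X X (show (2 * n - (i : ℕ)) + i = 2 * n by omega))
    (hΔ : ∑ i, π i = diagonalClass hX) (i : Fin (2 * n + 1)) :
    π i ∈ algebraicClasses (X ⊗ X) n := by
  -- every component off the middle index
  have hne : ∀ j : Fin (2 * n + 1), (j : ℕ) ≠ n → π j ∈ algebraicClasses (X ⊗ X) n := by
    intro j hj
    rcases Nat.even_or_odd (j : ℕ) with ⟨q, hq⟩ | hjodd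
    · -- `j = 2q`: the piece `H^{2(n - q)} ⊗ H^{2q}`, both degrees off the middle
      have hjlt := j.isLt
      exact kunnethComponent_diagonalClass_mem_algebraicClasses_of_eq_top hX hπ j (p := n - q) (q := q)
        (by omega) (by omega) (heven _ (by omega)) (heven _ (by omega))
    · -- `j` odd: `Hʲ = 0`
      haveI := hodd j hjodd hj
      rw [kunnethComponent_diagonalClass_eq_zero_of_subsingleton hπ j]
      exact Submodule.zero_mem _
  by_cases hi : (i : ℕ) = n
  · exact kunnethComponent_diagonalClass_mem_algebraicClasses_of_forall_ne hX hΔ i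
      fun j hj ↦ hne j fun h ↦ hj (Fin.ext (by omega))
  · exact hne i hi

/-- **`C(X)` for varieties with algebraic cohomology**: if all odd cohomology of `X(ℂ)` vanishes and
every `H^{2p}(X(ℂ); ℂ)` is spanned by algebraic classes (projective spaces, Grassmannians, …), every
Künneth component of `cl(Δ)` is algebraic. [cite: Voisin2025, §5.3 (42)] [cite: Kleiman1968AlgebraicCycles, §2] -/
theorem kunnethComponent_diagonalClass_mem_algebraicClasses_of_odd_vanishing
    (hX : IsSmoothProjective n X) (hodd : ∀ k : ℕ, Odd k → Subsingleton (complexBetti X k))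
    (heven : ∀ p : ℕ, algebraicClasses X p = ⊤)
    {π : Fin (2 * n + 1) → complexBetti (X ⊗ X) (2 * n)}
    (hπ : ∀ i : Fin (2 * n + 1), π i ∈ kunnethPiece X X (show (2 * n - (i : ℕ)) + i = 2 * n by omega))
    (hΔ : ∑ i, π i = diagonalClass hX) (i : Fin (2 * n + 1)) :
    π i ∈ algebraicClasses (X ⊗ X) n :=
  kunnethComponent_diagonalClass_mem_algebraicClasses_of_off_middle hX (fun k hk _ ↦ hodd k hk)
    (fun p _ ↦ heven p) hπ hΔ i

/-! ### §2 Smooth hypersurfaces of `ℙⁿ⁺¹_ℂ` -/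

section Hypersurface

variable {d : ℕ} {f : MvPolynomial (Fin (n + 2)) ℂ}

/-- **The Künneth standard conjecture holds for every smooth projective `n`-fold cut out in `ℙⁿ⁺¹_ℂ` by
a non-zero form.** Off the middle degree the cohomology of such an `X` is that of `ℙⁿ⁺¹` (Lefschetz
hyperplane theorem; Voisin II Cor. 1.24–1.25): `H^{2p} = N^p H^{2p}` for `2p ≠ n`
(`algebraicClasses_eq_top_of_isHypersurfaceCutOutBy`) and `Hᵏ = 0` for `k` odd, `k ≠ n`
(`subsingleton_complexBetti_of_odd`); so the general criterion applies.
[cite: VoisinHodgeII2003, §1.2.3 Cor. 1.24 and Cor. 1.25] [cite: Voisin2025, §3.2.1 (14) and §5.3 (42)]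
[cite: Kleiman1968AlgebraicCycles, §2] -/
theorem kunnethComponent_diagonalClass_mem_algebraicClasses_of_isHypersurfaceCutOutBy
    (hX : IsSmoothProjective n X) (hf : f.IsHomogeneous d) (hf0 : f ≠ 0)
    (h : IsHypersurfaceCutOutBy (n + 1) f X)
    {π : Fin (2 * n + 1) → complexBetti (X ⊗ X) (2 * n)}
    (hπ : ∀ i : Fin (2 * n + 1), π i ∈ kunnethPiece X X (show (2 * n - (i : ℕ)) + i = 2 * n by omega))
    (hΔ : ∑ i, π i = diagonalClass hX) (i : Fin (2 * n + 1)) :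
    π i ∈ algebraicClasses (X ⊗ X) n :=
  kunnethComponent_diagonalClass_mem_algebraicClasses_of_off_middle hX
    (fun _ hk hkn ↦ subsingleton_complexBetti_of_odd hX hf hf0 h hk hkn)
    (fun _ hp ↦ algebraicClasses_eq_top_of_isHypersurfaceCutOutBy hX hf hf0 h hp) hπ hΔ i

/-- **`C(X)` for every smooth hypersurface** in the tree's packaged sense `IsSmoothHypersurface n d X`
(`X` smooth projective of dimension `n`, cut out in `ℙⁿ⁺¹_ℂ` by an irreducible form of degree `d`).
[cite: VoisinHodgeII2003, §1.2.3 Cor. 1.24 and Cor. 1.25] [cite: Voisin2025, §3.2.1 (14)] -/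
theorem kunnethComponent_diagonalClass_mem_algebraicClasses_of_isSmoothHypersurface
    (hY : IsSmoothHypersurface n d X)
    {π : Fin (2 * n + 1) → complexBetti (X ⊗ X) (2 * n)}
    (hπ : ∀ i : Fin (2 * n + 1), π i ∈ kunnethPiece X X (show (2 * n - (i : ℕ)) + i = 2 * n by omega))
    (hΔ : ∑ i, π i = diagonalClass hY.1) (i : Fin (2 * n + 1)) :
    π i ∈ algebraicClasses (X ⊗ X) n := by
  obtain ⟨F, hFhom, hFirr, hcut⟩ := hY.2
  exact kunnethComponent_diagonalClass_mem_algebraicClasses_of_isHypersurfaceCutOutBy hY.1 hFhom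
    hFirr.ne_zero hcut hπ hΔ i

end Hypersurface

/-! ### §3 Projective space -/

/-- **The Künneth standard conjecture holds for `ℙᴺ_ℂ`**: all odd cohomology vanishes and every class
of even degree is algebraic (a multiple of a power of the hyperplane class), so every Künneth component
of `cl(Δ_{ℙᴺ})`, in every Künneth decomposition, is algebraic (`Hʲ(ℙᴺ(ℂ); ℂ) = 0` for odd `j`: the
tree's `subsingleton_complexBetti_projectiveSpace_of_odd`). [cite: HatcherAT2002, §2.2 Thm. 2.35 (iii)] [cite: Voisin2025, §3.2.1 (14)] [cite: Kleiman1968AlgebraicCycles, §2] -/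
theorem kunnethComponent_diagonalClass_mem_algebraicClasses_projectiveSpace (N : ℕ)
    {π : Fin (2 * N + 1) → complexBetti (projectiveSpace N ℂ ⊗ projectiveSpace N ℂ) (2 * N)}
    (hπ : ∀ i : Fin (2 * N + 1), π i ∈ kunnethPiece (projectiveSpace N ℂ) (projectiveSpace N ℂ)
      (show (2 * N - (i : ℕ)) + i = 2 * N by omega))
    (hΔ : ∑ i, π i =
      diagonalClass (isSmoothProjective_projectiveSpace_holds ℂ N : IsSmoothProjective N (projectiveSpace N ℂ)))
    (i : Fin (2 * N + 1)) :
    π i ∈ algebraicClasses (projectiveSpace N ℂ ⊗ projectiveSpace N ℂ) N := by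
  have hP : IsSmoothProjective N (projectiveSpace N ℂ) := isSmoothProjective_projectiveSpace_holds ℂ N
  refine kunnethComponent_diagonalClass_mem_algebraicClasses_of_odd_vanishing hP
    (fun k hk ↦ subsingleton_complexBetti_projectiveSpace_of_odd N hk) (fun p ↦ ?_) hπ hΔ i
  exact algebraicClasses_eq_top_of_surjective_map hP (𝟙 _)
    (by rw [complexBetti.map_id]; exact fun c ↦ ⟨c, rfl⟩)

end Literature.AlgebraicGeometry.HodgeTheory

end
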